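import Mathlib

/-!
# Sloped ladder, rung main term — part 1: pointwise bookkeeping

Route `LiouvilleShiftedTables` (Parity / GeneralizedHardyLittlewood), crux stmt-Parity-9389
(`PairsToGHL`), line `sloped_ladder`, stub `stub_rungMainPart`.

In the rung of Bombieri's asymptotic sieve for an adjoined form `ψ` against the tuple weight
`F(n) = ∏ᵢ Λ(Φᵢ(n))`, the main term is `M(N) = ∑_{n ≤ N} F(n) ∑_{d ≤ X(n)} μ(d) w̃(d) log(m(n)/d)`
with `m(n) = ψ(n)` and `X(n) = m(n)/(M₀+1)`, `M₀ = ⌊N^{ε₁}⌋`. Writing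
`A₀(x) = ∑_{d ≤ x} μ(d) w̃(d)` and `A₁(x) = ∑_{d ≤ x} μ(d) w̃(d) log d`, the inner sum is
`log m · A₀(X) - A₁(X)`. This file records, for an abstract weight `W` with `W 1 = 1` satisfying
the three Euler-product estimates `|A₀(x)| ≤ C/log² x`, `|A₁(x)| ≤ C`, `|𝔖 A₁(x) + 𝔖'| ≤ C/log x`
(`x ≥ 2`):

* `mainInner_eq` — the decomposition of the inner sum;
* `abs_A0_le`, `abs_A1_le`, `abs_mainInner_le_triv` — trivial bounds valid for every `x`;
* `abs_mainInner_le_good`, `abs_mul_mainInner_sub_le_good` — the bounds for `x ≥ 2` with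
  `log x ≥ (log N)/4`;
* `two_le_div_and_log_le` — for `N ≥ 256`, `n > √N`, `n ≤ m`: `X = m/(⌊N^{ε₁}⌋+1) ≥ 2` and
  `log X ≥ (log N)/4` (`ε₁ ≤ 1/8`);
* `eq_zero_of_abs_le_div_log` — `|a| ≤ C/log x` for all `x ≥ 2` forces `a = 0`;
* `eventually_sqrt_mul_le`, `eventually_abs_sub_le`, `eventually_le_mul`, `eventually_sqrt_le` —
  the eventual inequalities `√N (A log N + B) ≤ c N` and, from `S(N) - 𝔖 N = o(N)`,
  `|S(N) - 𝔖 N| ≤ κ N`, `S(N) ≤ (|𝔖|+1) N`, `S(⌊√N⌋) ≤ (|𝔖|+1) √N`.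

[folklore]
-/

noncomputable section

open Finset Real Filter
open scoped ArithmeticFunction.Moebius Topology

namespace Summit.Parity.GeneralizedHardyLittlewood.Theorems.PairsToGHL.SlopedLadder

namespace RungMain

/-! Throughout, `A₀(x) = ∑_{1 ≤ d ≤ x} μ(d) W(d)`, `A₁(x) = ∑_{1 ≤ d ≤ x} μ(d) W(d) log d`, and the
inner sum of the main term is `∑_{1 ≤ d ≤ x} μ(d) W(d) log(m/d)`; all three are written out. -/

variable {W : ℕ → ℝ} {C 𝔖 𝔖' : ℝ}

/-- `∑_{d ≤ x} μ(d) W(d) log(m/d) = log m · A₀(x) - A₁(x)` for `m ≥ 1`. [folklore] -/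
theorem mainInner_eq (W : ℕ → ℝ) {m : ℕ} (hm : 1 ≤ m) (x : ℕ) :
    (∑ d ∈ Icc 1 x, (μ d : ℝ) * W d * Real.log ((m : ℝ) / d)) =
      Real.log m * (∑ d ∈ Icc 1 x, (μ d : ℝ) * W d) -
        (∑ d ∈ Icc 1 x, (μ d : ℝ) * W d * Real.log d) := by
  rw [Finset.mul_sum, ← Finset.sum_sub_distrib]
  refine Finset.sum_congr rfl fun d hd => ?_
  have hd1 : 1 ≤ d := (Finset.mem_Icc.1 hd).1
  have hm0 : (m : ℝ) ≠ 0 := Nat.cast_ne_zero.2 (by omega)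
  have hd0 : (d : ℝ) ≠ 0 := Nat.cast_ne_zero.2 (by omega)
  rw [Real.log_div hm0 hd0]
  ring

/-- `A₀(0) = 0`. [folklore] -/
theorem A0_zero (W : ℕ → ℝ) : (∑ d ∈ Icc 1 0, (μ d : ℝ) * W d) = 0 := by
  simp

/-- `A₁(0) = 0`. [folklore] -/
theorem A1_zero (W : ℕ → ℝ) : (∑ d ∈ Icc 1 0, (μ d : ℝ) * W d * Real.log d) = 0 := by
  simp

/-- `A₀(1) = W(1)`. [folklore] -/
theorem A0_one (W : ℕ → ℝ) : (∑ d ∈ Icc 1 1, (μ d : ℝ) * W d) = W 1 := by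
  simp

/-- `A₁(1) = 0`. [folklore] -/
theorem A1_one (W : ℕ → ℝ) : (∑ d ∈ Icc 1 1, (μ d : ℝ) * W d * Real.log d) = 0 := by
  simp

/-- The constant `C` of the Euler estimates is non-negative (look at `|A₁(2)| ≤ C`). [folklore] -/
theorem nonneg_of_euler
    (hE : ∀ x : ℕ, 2 ≤ x → |(∑ d ∈ Icc 1 x, (μ d : ℝ) * W d * Real.log d)| ≤ C) : 0 ≤ C :=
  (abs_nonneg _).trans (hE 2 le_rfl)

/-- Uniform bound `|A₀(x)| ≤ C/log² 2 + 1` for every `x` (`W 1 = 1`). [folklore] -/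
theorem abs_A0_le (hW1 : W 1 = 1)
    (hE : ∀ x : ℕ, 2 ≤ x → |(∑ d ∈ Icc 1 x, (μ d : ℝ) * W d)| ≤ C / Real.log x ^ 2)
    (hC : 0 ≤ C) (x : ℕ) : |(∑ d ∈ Icc 1 x, (μ d : ℝ) * W d)| ≤ C / Real.log 2 ^ 2 + 1 := by
  have h2 : 0 < Real.log 2 := Real.log_pos one_lt_two
  have h0 : 0 ≤ C / Real.log 2 ^ 2 := by positivity
  rcases Nat.lt_or_ge x 2 with hx | hx
  · interval_cases x
    · rw [A0_zero, abs_zero]; linarith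
    · rw [A0_one, hW1, abs_one]; linarith
  · have hlog : Real.log 2 ≤ Real.log x := Real.log_le_log two_pos (by exact_mod_cast hx)
    calc |(∑ d ∈ Icc 1 x, (μ d : ℝ) * W d)| ≤ C / Real.log x ^ 2 := hE x hx
      _ ≤ C / Real.log 2 ^ 2 :=
          div_le_div_of_nonneg_left hC (by positivity) (pow_le_pow_left₀ h2.le hlog 2)
      _ ≤ C / Real.log 2 ^ 2 + 1 := by linarith

/-- Uniform bound `|A₁(x)| ≤ C` for every `x`. [folklore] -/
theorem abs_A1_le (hE : ∀ x : ℕ, 2 ≤ x → |(∑ d ∈ Icc 1 x, (μ d : ℝ) * W d * Real.log d)| ≤ C)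
    (x : ℕ) : |(∑ d ∈ Icc 1 x, (μ d : ℝ) * W d * Real.log d)| ≤ C := by
  have hC : 0 ≤ C := nonneg_of_euler hE
  rcases Nat.lt_or_ge x 2 with hx | hx
  · interval_cases x
    · rw [A1_zero, abs_zero]; exact hC
    · rw [A1_one, abs_zero]; exact hC
  · exact hE x hx

/-- Trivial bound: `|∑_{d ≤ x} μ W log(m/d)| ≤ log m · (C/log² 2 + 1) + C` for `m ≥ 1` and every
`x`. [folklore] -/
theorem abs_mainInner_le_triv (hW1 : W 1 = 1)
    (hE0 : ∀ x : ℕ, 2 ≤ x → |(∑ d ∈ Icc 1 x, (μ d : ℝ) * W d)| ≤ C / Real.log x ^ 2)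
    (hE1 : ∀ x : ℕ, 2 ≤ x → |(∑ d ∈ Icc 1 x, (μ d : ℝ) * W d * Real.log d)| ≤ C)
    {m : ℕ} (hm : 1 ≤ m) (x : ℕ) :
    |(∑ d ∈ Icc 1 x, (μ d : ℝ) * W d * Real.log ((m : ℝ) / d))| ≤
      Real.log m * (C / Real.log 2 ^ 2 + 1) + C := by
  have hC : 0 ≤ C := nonneg_of_euler hE1
  have hlogm : 0 ≤ Real.log m := Real.log_nonneg (by exact_mod_cast hm)
  rw [mainInner_eq W hm]
  set a0 := (∑ d ∈ Icc 1 x, (μ d : ℝ) * W d)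
  set a1 := (∑ d ∈ Icc 1 x, (μ d : ℝ) * W d * Real.log d)
  calc |Real.log m * a0 - a1| ≤ |Real.log m * a0| + |a1| := abs_sub _ _
    _ = Real.log m * |a0| + |a1| := by rw [abs_mul, abs_of_nonneg hlogm]
    _ ≤ Real.log m * (C / Real.log 2 ^ 2 + 1) + C :=
        add_le_add (mul_le_mul_of_nonneg_left (abs_A0_le hW1 hE0 hC x) hlogm) (abs_A1_le hE1 x)

/-- Good range: if `x ≥ 2`, `log x ≥ L/4 > 0`, `1 ≤ m`, `log m ≤ 2L`, then
`|∑_{d ≤ x} μ W log(m/d)| ≤ 32 C/L + C`. [folklore] -/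
theorem abs_mainInner_le_good
    (hE0 : ∀ x : ℕ, 2 ≤ x → |(∑ d ∈ Icc 1 x, (μ d : ℝ) * W d)| ≤ C / Real.log x ^ 2)
    (hE1 : ∀ x : ℕ, 2 ≤ x → |(∑ d ∈ Icc 1 x, (μ d : ℝ) * W d * Real.log d)| ≤ C)
    {x : ℕ} (hx : 2 ≤ x) {L : ℝ} (hL : 0 < L) (hlogx : L / 4 ≤ Real.log x)
    {m : ℕ} (hm : 1 ≤ m) (hlogm : Real.log m ≤ 2 * L) :
    |(∑ d ∈ Icc 1 x, (μ d : ℝ) * W d * Real.log ((m : ℝ) / d))| ≤ 32 * C / L + C := by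
  have hC : 0 ≤ C := nonneg_of_euler hE1
  have hlogm0 : 0 ≤ Real.log m := Real.log_nonneg (by exact_mod_cast hm)
  rw [mainInner_eq W hm]
  set a0 := (∑ d ∈ Icc 1 x, (μ d : ℝ) * W d)
  set a1 := (∑ d ∈ Icc 1 x, (μ d : ℝ) * W d * Real.log d)
  have hA0 : |a0| ≤ 16 * C / L ^ 2 := by
    calc |a0| ≤ C / Real.log x ^ 2 := hE0 x hx
      _ ≤ C / (L / 4) ^ 2 :=
          div_le_div_of_nonneg_left hC (by positivity) (pow_le_pow_left₀ (by positivity) hlogx 2)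
      _ = 16 * C / L ^ 2 := by field_simp; ring
  calc |Real.log m * a0 - a1| ≤ |Real.log m * a0| + |a1| := abs_sub _ _
    _ = Real.log m * |a0| + |a1| := by rw [abs_mul, abs_of_nonneg hlogm0]
    _ ≤ 2 * L * (16 * C / L ^ 2) + C :=
        add_le_add (mul_le_mul hlogm (hA0) (abs_nonneg _) (by positivity)) (abs_A1_le hE1 x)
    _ = 32 * C / L + C := by field_simp; ring

/-- Good range: if `x ≥ 2`, `log x ≥ L/4 > 0`, `1 ≤ m`, `log m ≤ 2L`, then
`|𝔖 ∑_{d ≤ x} μ W log(m/d) - 𝔖'| ≤ (32 |𝔖| C + 4 C)/L`. [folklore] -/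
theorem abs_mul_mainInner_sub_le_good
    (hE0 : ∀ x : ℕ, 2 ≤ x → |(∑ d ∈ Icc 1 x, (μ d : ℝ) * W d)| ≤ C / Real.log x ^ 2)
    (hE1 : ∀ x : ℕ, 2 ≤ x → |(∑ d ∈ Icc 1 x, (μ d : ℝ) * W d * Real.log d)| ≤ C)
    (hE2 : ∀ x : ℕ, 2 ≤ x →
      |𝔖 * (∑ d ∈ Icc 1 x, (μ d : ℝ) * W d * Real.log d) + 𝔖'| ≤ C / Real.log x)
    {x : ℕ} (hx : 2 ≤ x) {L : ℝ} (hL : 0 < L) (hlogx : L / 4 ≤ Real.log x)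
    {m : ℕ} (hm : 1 ≤ m) (hlogm : Real.log m ≤ 2 * L) :
    |𝔖 * (∑ d ∈ Icc 1 x, (μ d : ℝ) * W d * Real.log ((m : ℝ) / d)) - 𝔖'| ≤
      (32 * |𝔖| * C + 4 * C) / L := by
  have hC : 0 ≤ C := nonneg_of_euler hE1
  have hlogm0 : 0 ≤ Real.log m := Real.log_nonneg (by exact_mod_cast hm)
  rw [mainInner_eq W hm]
  set a0 := (∑ d ∈ Icc 1 x, (μ d : ℝ) * W d)
  set a1 := (∑ d ∈ Icc 1 x, (μ d : ℝ) * W d * Real.log d)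
  have hA0 : |a0| ≤ 16 * C / L ^ 2 := by
    calc |a0| ≤ C / Real.log x ^ 2 := hE0 x hx
      _ ≤ C / (L / 4) ^ 2 :=
          div_le_div_of_nonneg_left hC (by positivity) (pow_le_pow_left₀ (by positivity) hlogx 2)
      _ = 16 * C / L ^ 2 := by field_simp; ring
  have hA2 : |𝔖 * a1 + 𝔖'| ≤ 4 * C / L := by
    calc |𝔖 * a1 + 𝔖'| ≤ C / Real.log x := hE2 x hx
      _ ≤ C / (L / 4) := div_le_div_of_nonneg_left hC (by positivity) hlogx
      _ = 4 * C / L := by field_simp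
  have e : 𝔖 * (Real.log m * a0 - a1) - 𝔖' = 𝔖 * (Real.log m * a0) - (𝔖 * a1 + 𝔖') := by ring
  rw [e]
  calc |𝔖 * (Real.log m * a0) - (𝔖 * a1 + 𝔖')|
      ≤ |𝔖 * (Real.log m * a0)| + |𝔖 * a1 + 𝔖'| := abs_sub _ _
    _ = |𝔖| * (Real.log m * |a0|) + |𝔖 * a1 + 𝔖'| := by
        rw [abs_mul, abs_mul, abs_of_nonneg hlogm0]
    _ ≤ |𝔖| * (2 * L * (16 * C / L ^ 2)) + 4 * C / L :=
        add_le_add (mul_le_mul_of_nonneg_left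
          (mul_le_mul hlogm hA0 (abs_nonneg _) (by positivity)) (abs_nonneg _)) hA2
    _ = (32 * |𝔖| * C + 4 * C) / L := by field_simp; ring

/-- If `|a| ≤ C / log x` for every natural `x ≥ 2` then `a = 0`. [folklore] -/
theorem eq_zero_of_abs_le_div_log {a : ℝ} (h : ∀ x : ℕ, 2 ≤ x → |a| ≤ C / Real.log x) :
    a = 0 := by
  by_contra ha
  have hpos : 0 < |a| := abs_pos.2 ha
  have ht : Tendsto (fun x : ℕ => C / Real.log x) atTop (𝓝 0) :=
    tendsto_const_nhds.div_atTop (Real.tendsto_log_atTop.comp tendsto_natCast_atTop_atTop)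
  obtain ⟨x, hx1, hx2⟩ := ((ht.eventually (gt_mem_nhds hpos)).and (eventually_ge_atTop 2)).exists
  exact absurd (h x hx2) (not_le.2 hx1)

/-! ### The threshold `n > √N` -/

/-- For `N ≥ 256`: `2 ≤ N^{1/8}`. [folklore] -/
theorem two_le_rpow_eighth {N : ℕ} (hN : 256 ≤ N) : (2 : ℝ) ≤ (N : ℝ) ^ (1 / 8 : ℝ) := by
  have h256 : (256 : ℝ) ≤ N := by exact_mod_cast hN
  have e : (2 : ℝ) = (256 : ℝ) ^ (1 / 8 : ℝ) := by
    rw [show (256 : ℝ) = 2 ^ (8 : ℕ) by norm_num, ← Real.rpow_natCast_mul (by norm_num)]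
    norm_num
  rw [e]
  exact Real.rpow_le_rpow (by norm_num) h256 (by norm_num)

/-- Threshold: for `N ≥ 256`, `ε₁ ≤ 1/8`, `√N < n ≤ m`, the integer `X = m / (⌊N^{ε₁}⌋ + 1)`
satisfies `X ≥ 2` and `log X ≥ (log N)/4` (indeed `X ≥ ⌈N^{1/4}⌉`, because
`(N^{1/4} + 1)(N^{1/8} + 1) < N^{1/2} < n`). [folklore] -/
theorem two_le_div_and_log_le {N n m : ℕ} {ε₁ : ℝ} (hε : ε₁ ≤ 1 / 8) (hN : 256 ≤ N)
    (hn : Nat.sqrt N < n) (hm : n ≤ m) :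
    2 ≤ m / (⌊(N : ℝ) ^ ε₁⌋₊ + 1) ∧
      Real.log N / 4 ≤ Real.log ((m / (⌊(N : ℝ) ^ ε₁⌋₊ + 1) : ℕ) : ℝ) := by
  set u : ℝ := (N : ℝ) ^ (1 / 8 : ℝ) with hu
  have hN0 : (0 : ℝ) < N := by exact_mod_cast (show 0 < N by omega)
  have hN1 : (1 : ℝ) ≤ N := by exact_mod_cast (show 1 ≤ N by omega)
  have hu2 : 2 ≤ u := two_le_rpow_eighth hN
  have hu0 : 0 ≤ u := by linarith
  have hu4 : u ^ 4 = Real.sqrt N := by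
    rw [hu, ← Real.rpow_mul_natCast hN0.le, Real.sqrt_eq_rpow]; norm_num
  have hsqrt_lt : Real.sqrt N < n := by
    rw [Real.sqrt_lt' (by exact_mod_cast (show 0 < n by omega))]
    exact_mod_cast Nat.sqrt_lt'.1 hn
  set M₀ : ℕ := ⌊(N : ℝ) ^ ε₁⌋₊ with hM₀
  have hM₀le : (M₀ : ℝ) ≤ u :=
    (Nat.floor_le (by positivity)).trans (Real.rpow_le_rpow_of_exponent_le hN1 hε)
  set Q : ℕ := ⌈u ^ 2⌉₊ with hQ
  have hQlt : (Q : ℝ) < u ^ 2 + 1 := Nat.ceil_lt_add_one (by positivity)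
  have hQge : u ^ 2 ≤ (Q : ℝ) := Nat.le_ceil _
  have hpoly : (u ^ 2 + 1) * (u + 1) < u ^ 4 := by
    nlinarith [mul_nonneg (sub_nonneg.2 hu2) (by positivity : (0 : ℝ) ≤ u ^ 3 + u ^ 2 + u + 1)]
  have hQM : (Q : ℝ) * (M₀ + 1) < n := by
    calc (Q : ℝ) * (M₀ + 1) ≤ (u ^ 2 + 1) * (u + 1) :=
          mul_le_mul hQlt.le (by linarith) (by positivity) (by positivity)
      _ < u ^ 4 := hpoly
      _ = Real.sqrt N := hu4
      _ < n := hsqrt_lt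
  have hQM' : Q * (M₀ + 1) ≤ n := by exact_mod_cast hQM.le
  have hQX : Q ≤ m / (M₀ + 1) :=
    (Nat.le_div_iff_mul_le (Nat.succ_pos _)).2 (hQM'.trans hm)
  have hQXr : u ^ 2 ≤ ((m / (M₀ + 1) : ℕ) : ℝ) := hQge.trans (by exact_mod_cast hQX)
  have hu2sq : (4 : ℝ) ≤ u ^ 2 := by nlinarith
  refine ⟨?_, ?_⟩
  · have : (2 : ℝ) ≤ ((m / (M₀ + 1) : ℕ) : ℝ) := by linarith
    exact_mod_cast this
  · calc Real.log N / 4 = Real.log (u ^ 2) := by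
          rw [Real.log_pow, hu, Real.log_rpow hN0]; ring
      _ ≤ _ := Real.log_le_log (by positivity) hQXr

/-! ### Eventual inequalities -/

/-- `√N (A log N + B) ≤ c N` eventually, for `A, B ≥ 0`, `c > 0`. [folklore] -/
theorem eventually_sqrt_mul_le {A B c : ℝ} (hA : 0 ≤ A) (hB : 0 ≤ B) (hc : 0 < c) :
    ∀ᶠ N : ℕ in atTop, Real.sqrt N * (A * Real.log N + B) ≤ c * N := by
  have ht : Tendsto (fun N : ℕ => ((N : ℝ)) ^ (1 / 4 : ℝ)) atTop atTop :=
    (tendsto_rpow_atTop (by norm_num)).comp tendsto_natCast_atTop_atTop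
  filter_upwards [ht.eventually_ge_atTop ((4 * A + B) / c), eventually_ge_atTop 1] with N hN hN1
  set u : ℝ := (N : ℝ) ^ (1 / 4 : ℝ) with hu
  have hN0 : (0 : ℝ) < N := by exact_mod_cast (show 0 < N by omega)
  have hN1' : (1 : ℝ) ≤ N := by exact_mod_cast hN1
  have hu1 : 1 ≤ u := Real.one_le_rpow hN1' (by norm_num)
  have hsqrt : Real.sqrt N = u ^ 2 := by
    rw [hu, ← Real.rpow_mul_natCast hN0.le, Real.sqrt_eq_rpow]; norm_num
  have hNu : (N : ℝ) = u ^ 4 := by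
    rw [hu, ← Real.rpow_mul_natCast hN0.le]; norm_num
  have hlog : Real.log N ≤ 4 * u := by
    have := Real.log_le_rpow_div hN0.le (show (0 : ℝ) < 1 / 4 by norm_num)
    rw [← hu] at this
    linarith [show u / (1 / 4 : ℝ) = 4 * u by ring]
  have hkey : (4 * A + B) ≤ c * u := by
    have := (div_le_iff₀ hc).1 hN; linarith
  calc Real.sqrt N * (A * Real.log N + B) = u ^ 2 * (A * Real.log N + B) := by rw [hsqrt]
    _ ≤ u ^ 2 * (A * (4 * u) + B * u) := by
        apply mul_le_mul_of_nonneg_left _ (by positivity)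
        nlinarith [mul_le_mul_of_nonneg_left hlog hA]
    _ = u ^ 3 * (4 * A + B) := by ring
    _ ≤ u ^ 3 * (c * u) := mul_le_mul_of_nonneg_left hkey (by positivity)
    _ = c * u ^ 4 := by ring
    _ = c * N := by rw [hNu]

/-- From `S(N) - 𝔖 N = o(N)`: eventually `|S N - 𝔖 N| ≤ κ N`. [folklore] -/
theorem eventually_abs_sub_le {S : ℕ → ℝ} {𝔖 κ : ℝ}
    (hS : (fun N : ℕ => S N - 𝔖 * N) =o[atTop] fun N : ℕ => (N : ℝ)) (hκ : 0 < κ) :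
    ∀ᶠ N : ℕ in atTop, |S N - 𝔖 * N| ≤ κ * N := by
  filter_upwards [hS.bound hκ] with N hN
  simpa only [Real.norm_eq_abs, Nat.abs_cast] using hN

/-- From `S(N) - 𝔖 N = o(N)`: eventually `S N ≤ (|𝔖| + 1) N`. [folklore] -/
theorem eventually_le_mul {S : ℕ → ℝ} {𝔖 : ℝ}
    (hS : (fun N : ℕ => S N - 𝔖 * N) =o[atTop] fun N : ℕ => (N : ℝ)) :
    ∀ᶠ N : ℕ in atTop, S N ≤ (|𝔖| + 1) * N := by
  filter_upwards [eventually_abs_sub_le hS one_pos] with T hT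
  have := (abs_sub_le_iff.1 hT).1
  have h2 : 𝔖 * T ≤ |𝔖| * T := mul_le_mul_of_nonneg_right (le_abs_self _) (Nat.cast_nonneg _)
  linarith

/-- From `S(N) - 𝔖 N = o(N)`: eventually `S(⌊√N⌋) ≤ (|𝔖| + 1) √N`. [folklore] -/
theorem eventually_sqrt_le {S : ℕ → ℝ} {𝔖 : ℝ}
    (hS : (fun N : ℕ => S N - 𝔖 * N) =o[atTop] fun N : ℕ => (N : ℝ)) :
    ∀ᶠ N : ℕ in atTop, S (Nat.sqrt N) ≤ (|𝔖| + 1) * Real.sqrt N := by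
  have hsq : Tendsto Nat.sqrt atTop atTop :=
    Filter.tendsto_atTop_atTop.2 fun b => ⟨b ^ 2, fun a ha => by
      simpa [Nat.sqrt_eq'] using Nat.sqrt_le_sqrt ha⟩
  filter_upwards [hsq.eventually (eventually_le_mul hS)] with N hN
  exact hN.trans (mul_le_mul_of_nonneg_left Real.nat_sqrt_le_real_sqrt (by positivity))

end RungMain

/-! ### Registered sub-goal of this helper file -/

/-- **Part 1 of `stub_rungMainPart` (registered sub-goal `stub_rungMainPart_part1`).** The
threshold of the main-term estimate: for `N ≥ 256`, `ε₁ ≤ 1/8` and `√N < n ≤ m`, the level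
`X = m/(⌊N^{ε₁}⌋+1)` satisfies `X ≥ 2` and `log X ≥ (log N)/4`. [folklore] -/
theorem stub_rungMainPart_part1 :
    ∀ (N n m : ℕ) (ε₁ : ℝ), ε₁ ≤ 1 / 8 → 256 ≤ N → Nat.sqrt N < n → n ≤ m → 2 ≤ m / (⌊(N : ℝ) ^ ε₁⌋₊ + 1) ∧ Real.log N / 4 ≤ Real.log ((m / (⌊(N : ℝ) ^ ε₁⌋₊ + 1) : ℕ) : ℝ) :=
  fun _ _ _ _ hε hN hn hm => RungMain.two_le_div_and_log_le hε hN hn hm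

end Summit.Parity.GeneralizedHardyLittlewood.Theorems.PairsToGHL.SlopedLadder
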